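import Summits.Ventures.PercRepro.C026HubParallelMain
import Summits.Ventures.PercRepro.C026ProdCFMulti
import Summits.Ventures.PercRepro.C026ProdCFMono

/-!
# Theorem R (R0) in hypothesis form: a vertex joined only to `a` and `b` (p6, gen 14)

mine-3's (R0) (INBOX 6152) for an ARBITRARY marked multigraph `H`: if every edge at the non-mark `u` joins
`u` to the mark `a` or to the mark `b` (`k` edges to `a`, `l` edges to `b`), then
`Δ_CF(H) = (2^k + 2^l − 1)·Δ_CF(H − u)`, with `H − u = H.part (H.delSide u) true` (p5's `Mono` vocabulary).
This is the bridge of mine-3's (R1) «EM ⟹ MONO»: strip `u`'s off-mark edges, then apply (R0).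

Proof: `H` is the parallel hub `(H − u).hubPar u a b k l` (C026HubParallel) up to an
ORIENTATION-INSENSITIVE relabelling of the edges — p5's `IsRelabel` (C026ProdCFMulti) is orientation-exact,
so `IsRelabel'` (endpoints equal up to a swap) with the same invariance proofs is the new piece
(`conn_relabel'_iff`, `slackCF_relabel'`); the edge equivalence is `E ≃ E₀ ⊕ (A ⊕ B)` (`Equiv.sumCompl` twice)
followed by `A ≃ Fin k`, `B ≃ Fin l` (`Fintype.equivFin`); then `slackCF_hubPar` (C026HubParallelMain).
-/

namespace PercRepro

open Finset

namespace MultiGraph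

section RelabelSwap

variable {V E₁ E₂ : Type*}

/-- `G₂` is `G₁` with its edges relabelled along `ε`, each edge keeping its two endpoints up to a swap. -/
def IsRelabel' (G₁ : MultiGraph V E₁) (G₂ : MultiGraph V E₂) (ε : E₁ ≃ E₂) : Prop :=
  ∀ e, (G₂.fst (ε e) = G₁.fst e ∧ G₂.snd (ε e) = G₁.snd e) ∨
    (G₂.fst (ε e) = G₁.snd e ∧ G₂.snd (ε e) = G₁.fst e)

variable {G₁ : MultiGraph V E₁} {G₂ : MultiGraph V E₂} {ε : E₁ ≃ E₂}

/-- An open step of the relabelled graph pulls back, and conversely (orientation-insensitive). -/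
theorem openAdj_relabel'_iff (h : IsRelabel' G₁ G₂ ε) (ω : Config E₂) (x y : V) :
    G₁.OpenAdj (pullConfig ε ω) x y ↔ G₂.OpenAdj ω x y := by
  constructor
  · rintro ⟨e, he, hend⟩
    refine ⟨ε e, he, ?_⟩
    rcases h e with ⟨h1, h2⟩ | ⟨h1, h2⟩
    · rw [h1, h2]
      exact hend
    · rw [h1, h2]
      rcases hend with ⟨h3, h4⟩ | ⟨h3, h4⟩
      · exact Or.inr ⟨h4, h3⟩
      · exact Or.inl ⟨h4, h3⟩
  · rintro ⟨e, he, hend⟩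
    refine ⟨ε.symm e, ?_, ?_⟩
    · simpa [pullConfig] using he
    · rcases h (ε.symm e) with ⟨h1, h2⟩ | ⟨h1, h2⟩
      · rw [← h1, ← h2, Equiv.apply_symm_apply]
        exact hend
      · rw [← h1, ← h2, Equiv.apply_symm_apply]
        rcases hend with ⟨h3, h4⟩ | ⟨h3, h4⟩
        · exact Or.inr ⟨h4, h3⟩
        · exact Or.inl ⟨h4, h3⟩

/-- Connectivity is invariant under an orientation-insensitive relabelling. -/
theorem conn_relabel'_iff (h : IsRelabel' G₁ G₂ ε) (ω : Config E₂) (x y : V) :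
    G₁.Conn (pullConfig ε ω) x y ↔ G₂.Conn ω x y := by
  have e : G₁.OpenAdj (pullConfig ε ω) = G₂.OpenAdj ω := by
    funext x y
    exact propext (openAdj_relabel'_iff h ω x y)
  unfold Conn
  rw [e]

/-- The complement version. -/
theorem conn_compl_relabel'_iff (h : IsRelabel' G₁ G₂ ε) (ω : Config E₂) (x y : V) :
    G₁.Conn (pullConfig ε ω)ᶜ x y ↔ G₂.Conn ωᶜ x y := by
  rw [← pullConfig_compl, conn_relabel'_iff h]

open Classical in
/-- **`Δ_CF` is invariant under an orientation-insensitive relabelling.** -/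
theorem slackCF_relabel' [Fintype E₁] [Fintype E₂] (h : IsRelabel' G₁ G₂ ε) (a b c : V) :
    G₁.slackCF a b c = G₂.slackCF a b c := by
  unfold slackCF
  rw [card_filter_relabel ε, card_filter_relabel ε (fun ω => G₁.Conn ω c a ∧ ¬ G₁.Conn ω c b),
    card_filter_relabel ε (fun ω => G₁.Conn ω c b ∧ ¬ G₁.Conn ω c a),
    card_filter_relabel ε (fun ω => G₁.Conn ω a b ∧ ¬ G₁.Conn ωᶜ c a ∧ ¬ G₁.Conn ωᶜ c b)]
  simp only [conn_relabel'_iff h, conn_compl_relabel'_iff h]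

end RelabelSwap

section HubAny

variable {V E : Type*} {H : MultiGraph V E}

/-- An edge at three distinct vertices does not exist. -/
theorem not_edgeAt_three {e : E} {x y z : V} (hxy : x ≠ y) (hxz : x ≠ z) (hyz : y ≠ z)
    (hx : H.EdgeAt e x) (hy : H.EdgeAt e y) (hz : H.EdgeAt e z) : False := by
  unfold EdgeAt at hx hy hz
  rcases hx with hx | hx <;> rcases hy with hy | hy <;> rcases hz with hz | hz
  · exact hxy (hx.symm.trans hy)
  · exact hxy (hx.symm.trans hy)
  · exact hxz (hx.symm.trans hz)
  · exact hyz (hy.symm.trans hz)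
  · exact hyz (hy.symm.trans hz)
  · exact hxz (hx.symm.trans hz)
  · exact hxy (hx.symm.trans hy)
  · exact hxy (hx.symm.trans hy)

/-- The two endpoints of an edge at `u` and at `a ≠ u`, up to a swap. -/
theorem ends_of_edgeAt_two {e : E} {u a : V} (hua : u ≠ a) (hu : H.EdgeAt e u) (ha : H.EdgeAt e a) :
    (H.fst e = u ∧ H.snd e = a) ∨ (H.fst e = a ∧ H.snd e = u) := by
  unfold EdgeAt at hu ha
  rcases hu with hu | hu <;> rcases ha with ha | ha
  · exact absurd (hu.symm.trans ha) hua
  · exact Or.inl ⟨hu, ha⟩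
  · exact Or.inr ⟨ha, hu⟩
  · exact absurd (hu.symm.trans ha) hua

/-- `H − u` has `u` isolated. -/
theorem isolated_part_delSide (H : MultiGraph V E) (u : V) :
    (H.part (H.delSide u) true).Isolated u := by
  intro e
  have h2 := e.2
  simp only [delSide, decide_eq_true_eq] at h2
  unfold EdgeAt at h2
  exact ⟨fun h => h2 (Or.inl h), fun h => h2 (Or.inr h)⟩

open Classical in
/-- The edge map of the relabelling: the old edges, the `a`-class, the `b`-class. -/
noncomputable def hubAnyMap (H : MultiGraph V E) [Fintype E] (u a b : V) :
    {e // H.delSide u e = true} ⊕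
      (Fin (Fintype.card {e // H.EdgeAt e u ∧ H.EdgeAt e a}) ⊕
        Fin (Fintype.card {e // H.EdgeAt e u ∧ H.EdgeAt e b})) → E
  | Sum.inl e => e.1
  | Sum.inr (Sum.inl i) => ((Fintype.equivFin {e // H.EdgeAt e u ∧ H.EdgeAt e a}).symm i).1
  | Sum.inr (Sum.inr j) => ((Fintype.equivFin {e // H.EdgeAt e u ∧ H.EdgeAt e b}).symm j).1

open Classical in
/-- The edge map is a bijection when every edge at `u` goes to `a` or to `b` (`u, a, b` distinct). -/
theorem hubAnyMap_bijective (H : MultiGraph V E) [Fintype E] {u a b : V} (hua : u ≠ a) (hub : u ≠ b)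
    (hab : a ≠ b) (h : ∀ e, H.EdgeAt e u → (H.EdgeAt e a ∨ H.EdgeAt e b)) :
    Function.Bijective (H.hubAnyMap u a b) := by
  constructor
  · intro x y hxy
    rcases x with e | i | j <;> rcases y with e' | i' | j' <;> simp only [hubAnyMap] at hxy
    · exact congrArg Sum.inl (Subtype.ext hxy)
    · exfalso
      have h1 := e.2
      simp only [delSide, decide_eq_true_eq] at h1
      have h2 := ((Fintype.equivFin {e // H.EdgeAt e u ∧ H.EdgeAt e a}).symm i').2
      rw [← hxy] at h2
      exact h1 h2.1
    · exfalso
      have h1 := e.2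
      simp only [delSide, decide_eq_true_eq] at h1
      have h2 := ((Fintype.equivFin {e // H.EdgeAt e u ∧ H.EdgeAt e b}).symm j').2
      rw [← hxy] at h2
      exact h1 h2.1
    · exfalso
      have h1 := e'.2
      simp only [delSide, decide_eq_true_eq] at h1
      have h2 := ((Fintype.equivFin {e // H.EdgeAt e u ∧ H.EdgeAt e a}).symm i).2
      rw [hxy] at h2
      exact h1 h2.1
    · have := Subtype.ext hxy
      rw [Equiv.symm_apply_eq] at this
      rw [this, Equiv.apply_symm_apply]
    · exfalso
      have h2 := ((Fintype.equivFin {e // H.EdgeAt e u ∧ H.EdgeAt e a}).symm i).2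
      have h3 := ((Fintype.equivFin {e // H.EdgeAt e u ∧ H.EdgeAt e b}).symm j').2
      rw [hxy] at h2
      exact not_edgeAt_three hua hub hab h3.1 h2.2 h3.2
    · exfalso
      have h1 := e'.2
      simp only [delSide, decide_eq_true_eq] at h1
      have h2 := ((Fintype.equivFin {e // H.EdgeAt e u ∧ H.EdgeAt e b}).symm j).2
      rw [hxy] at h2
      exact h1 h2.1
    · exfalso
      have h2 := ((Fintype.equivFin {e // H.EdgeAt e u ∧ H.EdgeAt e a}).symm i').2
      have h3 := ((Fintype.equivFin {e // H.EdgeAt e u ∧ H.EdgeAt e b}).symm j).2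
      rw [← hxy] at h2
      exact not_edgeAt_three hua hub hab h3.1 h2.2 h3.2
    · have := Subtype.ext hxy
      rw [Equiv.symm_apply_eq] at this
      rw [this, Equiv.apply_symm_apply]
  · intro e
    by_cases hu : H.EdgeAt e u
    · rcases h e hu with ha | hb
      · refine ⟨Sum.inr (Sum.inl ((Fintype.equivFin {e // H.EdgeAt e u ∧ H.EdgeAt e a}) ⟨e, hu, ha⟩)), ?_⟩
        simp only [hubAnyMap, Equiv.symm_apply_apply]
      · refine ⟨Sum.inr (Sum.inr ((Fintype.equivFin {e // H.EdgeAt e u ∧ H.EdgeAt e b}) ⟨e, hu, hb⟩)), ?_⟩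
        simp only [hubAnyMap, Equiv.symm_apply_apply]
    · refine ⟨Sum.inl ⟨e, ?_⟩, rfl⟩
      simp only [delSide, decide_eq_true_eq]
      exact hu

open Classical in
/-- `H` is the parallel hub of `H − u` up to an orientation-insensitive relabelling. -/
theorem isRelabel'_hubPar (H : MultiGraph V E) [Fintype E] {u a b : V} (hua : u ≠ a) (hub : u ≠ b)
    (hab : a ≠ b) (h : ∀ e, H.EdgeAt e u → (H.EdgeAt e a ∨ H.EdgeAt e b)) :
    IsRelabel' ((H.part (H.delSide u) true).hubPar u a b
        (Fintype.card {e // H.EdgeAt e u ∧ H.EdgeAt e a})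
        (Fintype.card {e // H.EdgeAt e u ∧ H.EdgeAt e b})) H
      (Equiv.ofBijective _ (hubAnyMap_bijective H hua hub hab h)) := by
  intro x
  rcases x with e | i | j
  · exact Or.inl ⟨rfl, rfl⟩
  · have h2 := ((Fintype.equivFin {e // H.EdgeAt e u ∧ H.EdgeAt e a}).symm i).2
    rcases ends_of_edgeAt_two hua h2.1 h2.2 with ⟨h3, h4⟩ | ⟨h3, h4⟩
    · exact Or.inl ⟨h3, h4⟩
    · exact Or.inr ⟨h3, h4⟩
  · have h2 := ((Fintype.equivFin {e // H.EdgeAt e u ∧ H.EdgeAt e b}).symm j).2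
    rcases ends_of_edgeAt_two hub h2.1 h2.2 with ⟨h3, h4⟩ | ⟨h3, h4⟩
    · exact Or.inl ⟨h3, h4⟩
    · exact Or.inr ⟨h3, h4⟩

open Classical in
/-- **Theorem R (R0), hypothesis form**: if every edge at the non-mark `u` joins `u` to `a` or to `b`
(`k` edges to `a`, `l` edges to `b`), then `Δ_CF(H) = (2^k + 2^l − 1)·Δ_CF(H − u)`. -/
theorem slackCF_eq_of_hubAB (H : MultiGraph V E) [Fintype E] {u a b c : V} (hua : u ≠ a) (hub : u ≠ b)
    (huc : u ≠ c) (hab : a ≠ b) (h : ∀ e, H.EdgeAt e u → (H.EdgeAt e a ∨ H.EdgeAt e b)) :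
    H.slackCF a b c =
      (2 ^ (univ.filter fun e => H.EdgeAt e u ∧ H.EdgeAt e a).card +
        2 ^ (univ.filter fun e => H.EdgeAt e u ∧ H.EdgeAt e b).card - 1) *
        (H.part (H.delSide u) true).slackCF a b c := by
  rw [← slackCF_relabel' (isRelabel'_hubPar H hua hub hab h) a b c,
    slackCF_hubPar (isolated_part_delSide H u) hua.symm hub.symm huc.symm,
    Fintype.card_subtype, Fintype.card_subtype]

end HubAny

end MultiGraph

end PercRepro
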